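import Mathlib
import HarnessLib

/-!
# Real-axis data of meromorphic Herglotz (Pick–Nevanlinna) functions

Topic `Analysis/Complex`. DEFINITION `MeromorphicHerglotzData` (request `defn-MeromorphicHerglotzData`,
wanted by crux stmt-RiemannHypothesis-11196, line `pick-slope`, where the same structure is called
`PickParam`): the parameters `(a, b, (s_k), (c_k))` of a MEROMORPHIC Herglotz function
```
  τ(z) = a z + b + Σ_k c_k (1/(s_k - z) - s_k/(1 + s_k²)),   a ≥ 0, b ∈ ℝ, c_k > 0,
```
with distinct, locally finite real poles `s_k` and `Σ_k c_k/(1 + s_k²) < ∞`, together with its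
real-axis trace `val`, its derivative series `slope`, its pole set `poles` and the residue weights
`weight`; plus the elementary API (the two Mittag-Leffler series converge absolutely at EVERY real
point, the weights sit exactly at the poles, the pole set is locally finite and the index set countable).

## Sources

* F. Gesztesy, E. Tsekanovskii, *On matrix-valued Herglotz functions*, Math. Nachr. 218 (2000)
  [GesztesyTsekanovskii2000] (held: `lit read arxiv:funct-an/9712004`). Theorem 2.2 (iii): every
  Herglotz function (`m` analytic on `ℂ₊` with `Im m ≥ 0`) has the Nevanlinna–Riesz–Herglotz
  representation `m(z) = c + d z + ∫_ℝ dω(λ) ((λ - z)⁻¹ - λ(1 + λ²)⁻¹)`, `d ≥ 0`, `c = Re m(i)`, with a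
  Borel measure `ω` satisfying `∫_ℝ dω(λ)(1 + λ²)⁻¹ < ∞` (2.13)–(2.14); Theorem 2.2 (vi): "Any poles …
  of `m` are simple and located on the real axis, the residues at poles being negative"; §3 (p. 9 of
  the arXiv version, proof of Theorem 3.3): the representing measure is a DISCRETE point measure
  (pure point, support without finite accumulation points) "if and only if `m_a(z)` is meromorphic on
  `ℂ`". With `ω = Σ_k c_k δ_{s_k}` the representation (2.14) is literally the series above and (2.13)
  is the field `summable`.
* B. Ja. Levin, *Distribution of zeros of entire functions*, Transl. Math. Monogr. 5, AMS 1964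
  (rev. 1980) [Levin1964], Ch. VII §1 (Chebotarev's theorem on real meromorphic functions mapping
  `ℂ⁺` into `ℂ⁺`; Theorem 1, p. 308 is the product form), as re-proved in M. Möller, V. Pivovarchik,
  *Spectral theory of operator pencils, Hermite–Biehler functions, and their applications*,
  Birkhäuser 2015 [MollerPivovarchik2015], §11.1: Lemma 11.1.3 (all zeros and poles of such `θ` are
  real, simple and interlace, and `θ′(x) > 0` off the poles) and Theorem 11.1.6.

## Rendering and design

* The index type `ι` of the poles is a FIELD (it may be empty — real affine functions `a z + b` — or
  finite — rational Herglotz functions — or countably infinite, cf. `countable_index`), exactly as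
  the requesting line uses it (`Option MeromorphicHerglotzData` as a parameter space). Hence
  `MeromorphicHerglotzData : Type 1`.
* Local finiteness of the poles is `∀ K, {k | |s k| ≤ K}.Finite` on indices; with `s_injective` this
  is local finiteness of the pole SET (`finite_poles_inter_Icc`).
* `val t` is the real series evaluated at a real `t`; at a pole `t = s_k` the `k`-th term carries
  Lean's junk value `1/0 = 0`, so `val`/`slope` are finite but meaningless AT the poles (documented
  junk; users evaluate them off `poles`, and use `weight` at the poles). Off the exceptional finite
  set of indices the terms are dominated by a multiple of `c_k/(1 + s_k²)`, so both series are
  genuinely (absolutely) summable at every real point: `summable_val_term`, `summable_slope_term`.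
* `herglotzFun` is the same series at complex `z` (the meromorphic Herglotz function itself, junk
  at the poles); `herglotzFun_ofReal` identifies its real-axis values with `val`.

NOT here (asked for later by the requesting line, not part of this request): `HasDerivAt val
(slope x) x` off the poles, the polar expansion `val t = c_k/(s_k - t) + O(1)` at `s_k`, and
`IsPickFunction herglotzFun` / the converse (Chebotarev–Levin: every real meromorphic Herglotz
function arises this way).
-/

noncomputable section

open Set Filter
open scoped Topology BigOperators

namespace Literature.Analysis.Complex

/-- **Real-axis data of a meromorphic Herglotz (Pick–Nevanlinna) function with real simple poles**
(Chebotarev–Levin form): the parameters of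
`τ(z) = a z + b + Σ_k c_k (1/(s_k - z) - s_k/(1 + s_k²))` with `a ≥ 0`, `b ∈ ℝ`, `c_k > 0`,
distinct locally finite real poles `s_k` and `Σ_k c_k/(1 + s_k²) < ∞` — i.e. the Nevanlinna
representation `m(z) = c + dz + ∫ ((λ - z)⁻¹ - λ(1 + λ²)⁻¹) dω(λ)`, `∫ dω/(1 + λ²) < ∞`, of a
Herglotz function whose representing measure `ω = Σ_k c_k δ_{s_k}` is a discrete point measure,
which is the case exactly when the Herglotz function is meromorphic on `ℂ`; its poles `s_k` are then
real and simple with residue `-c_k < 0`. The index type `ι` may be empty or finite (real affine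
functions, rational Herglotz functions). Called `PickParam` by the requesting line.
[cite: GesztesyTsekanovskii2000, Thm 2.2 (iii),(vi) and §3 (discrete point measure iff meromorphic); Levin1964, Ch. VII §1 (Chebotarev's theorem); MollerPivovarchik2015, Lemma 11.1.3 and Thm 11.1.6] -/
structure MeromorphicHerglotzData where
  /-- index set of the poles -/
  ι : Type
  /-- linear coefficient (`≥ 0`) -/
  a : ℝ
  /-- real constant -/
  b : ℝ
  /-- the poles -/
  s : ι → ℝ
  /-- the (positive) weights: `τ(z) ∼ c_k/(s_k - z)` at `s_k` -/
  c : ι → ℝ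
  a_nonneg : 0 ≤ a
  c_pos : ∀ k, 0 < c k
  s_injective : Function.Injective s
  poles_locallyFinite : ∀ K : ℝ, {k | |s k| ≤ K}.Finite
  summable : Summable fun k => c k / (1 + s k ^ 2)

namespace MeromorphicHerglotzData

variable (τ : MeromorphicHerglotzData)

/-- The pole set `{s_k}` of `τ`. [folklore] -/
def poles : Set ℝ := range τ.s

/-- `τ(t) = a t + b + Σ_k c_k (1/(s_k - t) - s_k/(1 + s_k²))` on the real axis (at a pole `t = s_k`
the `k`-th term is Lean's junk `1/0 = 0`, so the value there is finite but meaningless).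
[cite: GesztesyTsekanovskii2000, Thm 2.2 (iii), (2.14) with a discrete point measure] -/
def val (t : ℝ) : ℝ :=
  τ.a * t + τ.b + ∑' k, τ.c k * (1 / (τ.s k - t) - τ.s k / (1 + τ.s k ^ 2))

/-- `τ′(t) = a + Σ_k c_k/(s_k - t)²` off the poles (termwise derivative of `val`; `> 0` unless `τ` is
constant, cf. `slope_pos`). [cite: MollerPivovarchik2015, Lemma 11.1.3 (θ′(x) > 0 off the poles)] -/
def slope (t : ℝ) : ℝ :=
  τ.a + ∑' k, τ.c k / (τ.s k - t) ^ 2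

open Classical in
/-- The weight `c_k` at a pole `t = s_k` (minus the residue of `τ` there); junk `0` off the poles.
[cite: GesztesyTsekanovskii2000, Thm 2.2 (vi)] -/
def weight (t : ℝ) : ℝ :=
  if h : ∃ k, τ.s k = t then τ.c h.choose else 0

/-- The meromorphic Herglotz function itself, `τ(z) = a z + b + Σ_k c_k (1/(s_k - z) - s_k/(1 + s_k²))`
for complex `z` (junk at the poles, as for `val`).
[cite: GesztesyTsekanovskii2000, Thm 2.2 (iii), (2.14) with a discrete point measure] -/
def herglotzFun (z : ℂ) : ℂ :=
  (τ.a : ℂ) * z + τ.b + ∑' k, (τ.c k : ℂ) * (1 / ((τ.s k : ℂ) - z) - (τ.s k : ℂ) / (1 + (τ.s k : ℂ) ^ 2))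

/-! ### Poles and weights -/

/-- Membership in the pole set. [folklore] -/
theorem mem_poles_iff {t : ℝ} : t ∈ τ.poles ↔ ∃ k, τ.s k = t := Iff.rfl

/-- Each `s_k` is a pole. [folklore] -/
@[simp] theorem s_mem_poles (k : τ.ι) : τ.s k ∈ τ.poles := ⟨k, rfl⟩

/-- The weight at the pole `s_k` is `c_k` (uses injectivity of `s`). [folklore] -/
@[simp] theorem weight_apply_pole (k : τ.ι) : τ.weight (τ.s k) = τ.c k := by
  classical
  have h : ∃ j, τ.s j = τ.s k := ⟨k, rfl⟩
  rw [weight, dif_pos h, τ.s_injective h.choose_spec]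

/-- Off the poles the weight is the junk value `0`. [folklore] -/
theorem weight_of_not_mem_poles {t : ℝ} (ht : t ∉ τ.poles) : τ.weight t = 0 := by
  classical
  rw [weight, dif_neg]
  exact fun h => ht ((τ.mem_poles_iff).2 h)

/-- At a pole the weight is positive. [folklore] -/
theorem weight_pos_of_mem_poles {t : ℝ} (ht : t ∈ τ.poles) : 0 < τ.weight t := by
  obtain ⟨k, rfl⟩ := ht
  rw [weight_apply_pole]
  exact τ.c_pos k

/-- The weight is positive exactly at the poles. [folklore] -/
theorem weight_pos_iff {t : ℝ} : 0 < τ.weight t ↔ t ∈ τ.poles := by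
  refine ⟨fun h => ?_, τ.weight_pos_of_mem_poles⟩
  by_contra ht
  rw [τ.weight_of_not_mem_poles ht] at h
  exact lt_irrefl 0 h

/-- The pole SET is locally finite: only finitely many poles in each `[-K, K]`. [folklore] -/
theorem finite_poles_inter_Icc (K : ℝ) : (τ.poles ∩ Icc (-K) K).Finite := by
  have hsub : τ.poles ∩ Icc (-K) K ⊆ τ.s '' {k | |τ.s k| ≤ K} := by
    rintro _ ⟨⟨k, rfl⟩, hk⟩
    exact ⟨k, abs_le.mpr ⟨hk.1, hk.2⟩, rfl⟩
  exact ((τ.poles_locallyFinite K).image _).subset hsub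

/-- The index type of the poles is countable (a locally finite family of distinct reals).
[folklore] -/
theorem countable_index : Countable τ.ι := by
  have huniv : (univ : Set τ.ι) = ⋃ n : ℕ, {k | |τ.s k| ≤ n} := by
    ext k
    simp only [mem_univ, mem_iUnion, mem_setOf_eq, true_iff]
    exact exists_nat_ge |τ.s k|
  have hc : (univ : Set τ.ι).Countable := by
    rw [huniv]
    exact countable_iUnion fun n => (τ.poles_locallyFinite n).countable
  exact countable_univ_iff.mp hc

/-- Indices whose pole is far from `t` (`|s_k| > 2|t| + 1`) form a cofinite set. [folklore] -/
theorem eventually_cofinite_far (t : ℝ) : ∀ᶠ k in cofinite, 2 * |t| + 1 < |τ.s k| := by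
  rw [Filter.eventually_cofinite]
  refine (τ.poles_locallyFinite (2 * |t| + 1)).subset fun k hk => ?_
  simpa only [mem_setOf_eq, not_lt] using hk

/-! ### Absolute convergence of the two Mittag-Leffler series at every real point -/

/-- Far from `t` the pole does not coincide with `t`. [folklore] -/
theorem sub_ne_zero_of_far {t u : ℝ} (hu : 2 * |t| + 1 < |u|) : u - t ≠ 0 := by
  intro h
  rw [sub_eq_zero] at h
  subst h
  linarith [abs_nonneg u]

/-- Far from `t`: `|u| + 1 ≤ 2 |u - t|`. [folklore] -/
theorem abs_add_one_le_of_far {t u : ℝ} (hu : 2 * |t| + 1 < |u|) : |u| + 1 ≤ 2 * |u - t| := by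
  have := abs_sub_abs_le_abs_sub u t
  linarith

/-- Far from `t`: `1 + u² ≤ 4 (u - t)²`, the comparison behind `summable_slope_term`. [folklore] -/
theorem one_add_sq_le_of_far {t u : ℝ} (hu : 2 * |t| + 1 < |u|) :
    1 + u ^ 2 ≤ 4 * (u - t) ^ 2 := by
  have h1 := abs_add_one_le_of_far hu
  have h0 : 0 ≤ |u| + 1 := by positivity
  have h2 : (|u| + 1) ^ 2 ≤ (2 * |u - t|) ^ 2 := pow_le_pow_left₀ h0 h1 2
  nlinarith [sq_abs (u - t), sq_abs u, abs_nonneg u, h2]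

/-- Far from `t`: `|1 + u t| ≤ 2 (1 + |t|) |u - t|`, the comparison behind `summable_val_term`.
[folklore] -/
theorem abs_one_add_mul_le_of_far {t u : ℝ} (hu : 2 * |t| + 1 < |u|) :
    |1 + u * t| ≤ 2 * (1 + |t|) * |u - t| := by
  have h1 := abs_add_one_le_of_far hu
  calc |1 + u * t| ≤ |(1 : ℝ)| + |u * t| := abs_add_le _ _
    _ = 1 + |u| * |t| := by rw [abs_one, abs_mul]
    _ ≤ (1 + |t|) * (|u| + 1) := by nlinarith [abs_nonneg u, abs_nonneg t]
    _ ≤ (1 + |t|) * (2 * |u - t|) := mul_le_mul_of_nonneg_left h1 (by positivity)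
    _ = 2 * (1 + |t|) * |u - t| := by ring

/-- **The derivative series converges absolutely at every real point**: `Σ_k c_k/(s_k - t)²` is
summable for all `t ∈ ℝ` (at a pole the offending term is the junk `c_k/0 = 0`), by comparison with
`4 Σ_k c_k/(1 + s_k²)` off the finitely many indices with `|s_k| ≤ 2|t| + 1`. [folklore] -/
theorem summable_slope_term (t : ℝ) : Summable fun k => τ.c k / (τ.s k - t) ^ 2 := by
  refine Summable.of_norm_bounded_eventually (τ.summable.mul_left 4) ?_
  filter_upwards [τ.eventually_cofinite_far t] with k hk
  have hc := (τ.c_pos k).le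
  have hpos : 0 < (τ.s k - t) ^ 2 := by
    have := sub_ne_zero_of_far hk
    positivity
  have hq : 0 < 1 + τ.s k ^ 2 := by positivity
  rw [Real.norm_eq_abs, abs_of_nonneg (div_nonneg hc hpos.le), div_le_iff₀ hpos]
  calc τ.c k = τ.c k / (1 + τ.s k ^ 2) * (1 + τ.s k ^ 2) := by field_simp
    _ ≤ τ.c k / (1 + τ.s k ^ 2) * (4 * (τ.s k - t) ^ 2) :=
        mul_le_mul_of_nonneg_left (one_add_sq_le_of_far hk) (div_nonneg hc hq.le)
    _ = 4 * (τ.c k / (1 + τ.s k ^ 2)) * (τ.s k - t) ^ 2 := by ring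

/-- **The value series converges absolutely at every real point**:
`Σ_k c_k (1/(s_k - t) - s_k/(1 + s_k²))` is summable for all `t ∈ ℝ`, by comparison with
`2(1 + |t|) Σ_k c_k/(1 + s_k²)` off the finitely many indices with `|s_k| ≤ 2|t| + 1`
(there `1/(s_k - t) - s_k/(1 + s_k²) = (1 + s_k t)/((s_k - t)(1 + s_k²))`). [folklore] -/
theorem summable_val_term (t : ℝ) :
    Summable fun k => τ.c k * (1 / (τ.s k - t) - τ.s k / (1 + τ.s k ^ 2)) := by
  refine Summable.of_norm_bounded_eventually (τ.summable.mul_left (2 * (1 + |t|))) ?_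
  filter_upwards [τ.eventually_cofinite_far t] with k hk
  have hc := (τ.c_pos k).le
  have hst : τ.s k - t ≠ 0 := sub_ne_zero_of_far hk
  have hq : 0 < 1 + τ.s k ^ 2 := by positivity
  have habs : 0 < |τ.s k - t| := abs_pos.mpr hst
  have heq : 1 / (τ.s k - t) - τ.s k / (1 + τ.s k ^ 2) =
      (1 + τ.s k * t) / ((τ.s k - t) * (1 + τ.s k ^ 2)) := by
    field_simp
    ring
  rw [heq, norm_mul, norm_div, norm_mul, Real.norm_eq_abs, Real.norm_eq_abs, Real.norm_eq_abs,
    Real.norm_eq_abs, abs_of_nonneg hc, abs_of_pos hq]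
  calc τ.c k * (|1 + τ.s k * t| / (|τ.s k - t| * (1 + τ.s k ^ 2)))
      ≤ τ.c k * (2 * (1 + |t|) * |τ.s k - t| / (|τ.s k - t| * (1 + τ.s k ^ 2))) := by
        gcongr
        exact abs_one_add_mul_le_of_far hk
    _ = 2 * (1 + |t|) * (τ.c k / (1 + τ.s k ^ 2)) := by
        field_simp

/-- `val` is the sum of its (summable) series: `HasSum` form. [folklore] -/
theorem hasSum_val (t : ℝ) :
    HasSum (fun k => τ.c k * (1 / (τ.s k - t) - τ.s k / (1 + τ.s k ^ 2)))
      (τ.val t - τ.a * t - τ.b) := by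
  have h := (τ.summable_val_term t).hasSum
  convert h using 1
  rw [val]
  ring

/-- `slope` is the sum of its (summable) series: `HasSum` form. [folklore] -/
theorem hasSum_slope (t : ℝ) :
    HasSum (fun k => τ.c k / (τ.s k - t) ^ 2) (τ.slope t - τ.a) := by
  have h := (τ.summable_slope_term t).hasSum
  convert h using 1
  rw [slope]
  ring

/-! ### Positivity of the slope -/

/-- `a ≤ τ′(t)`: the pole part of the slope is nonnegative. [folklore] -/
theorem a_le_slope (t : ℝ) : τ.a ≤ τ.slope t :=
  le_add_of_nonneg_right (tsum_nonneg fun k => div_nonneg (τ.c_pos k).le (sq_nonneg _))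

/-- `0 ≤ τ′(t)` everywhere on the real axis. [folklore] -/
theorem slope_nonneg (t : ℝ) : 0 ≤ τ.slope t :=
  τ.a_nonneg.trans (τ.a_le_slope t)

/-- `τ′(t) > 0` off the poles as soon as there is at least one pole (Möller–Pivovarchik,
Lemma 11.1.3: `θ′(x) > 0` for every real non-pole `x`; here read off the series).
[cite: MollerPivovarchik2015, Lemma 11.1.3] -/
theorem slope_pos [Nonempty τ.ι] {t : ℝ} (ht : t ∉ τ.poles) : 0 < τ.slope t := by
  obtain ⟨k⟩ := ‹Nonempty τ.ι›
  have hk : 0 < τ.c k / (τ.s k - t) ^ 2 := by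
    have hne : τ.s k - t ≠ 0 := sub_ne_zero.2 fun h => ht ⟨k, h⟩
    exact div_pos (τ.c_pos k) (by positivity)
  have hsum : 0 < ∑' j, τ.c j / (τ.s j - t) ^ 2 :=
    (τ.summable_slope_term t).tsum_pos (fun j => div_nonneg (τ.c_pos j).le (sq_nonneg _)) k hk
  rw [slope]
  exact lt_add_of_le_of_pos τ.a_nonneg hsum

/-- `τ′(t) > 0` everywhere when the linear coefficient is positive. [folklore] -/
theorem slope_pos_of_a_pos (ha : 0 < τ.a) (t : ℝ) : 0 < τ.slope t :=
  ha.trans_le (τ.a_le_slope t)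

/-! ### The complex function on the real axis -/

/-- On the real axis the meromorphic Herglotz function is (the complexification of) `val`.
[folklore] -/
theorem herglotzFun_ofReal (t : ℝ) : τ.herglotzFun t = (τ.val t : ℂ) := by
  simp only [herglotzFun, val, Complex.ofReal_add, Complex.ofReal_mul, Complex.ofReal_tsum,
    Complex.ofReal_sub, Complex.ofReal_div, Complex.ofReal_one, Complex.ofReal_pow]

end MeromorphicHerglotzData

end Literature.Analysis.Complex

end
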